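import Literature.FieldTheory.Kummer.KummerFiniteRank
import Mathlib.FieldTheory.KummerPolynomial
import Mathlib.RingTheory.Norm.Basic
import HarnessLib

/-!
# Kummer theory of finite rank and prime exponent: degree `pᵏ` and surjectivity on exponents

The tree's `Literature.FieldTheory.Kummer.KummerFiniteRank` (Lang, *Algebra* VI §8, Thm. 8.1) proves
`[L(y₁, …, y_k) : L] = nᵏ` for `yᵢⁿ = cᵢ ∈ Lˣ` independent modulo `n`-th powers under the extra
hypothesis `√−1 ∈ L` (needed for general `n` because of the exceptional case of `Xⁿ − a`).
For a **prime** exponent `n = p` no such hypothesis is needed: `Xᵖ − a` is irreducible as soon as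
`a` is not a `p`-th power (Mathlib `X_pow_sub_C_irreducible_of_prime`).  This file records that
case, the resulting surjectivity of the exponent representation
`Gal(L(y)/L) → (ℤ/p)ᵏ, σ ↦ (aᵢ(σ))` (`σ(yᵢ) = ζ^{aᵢ(σ)} yᵢ`), and the transfer of independence
modulo `p`-th powers along a finite extension of degree prime to `p` (the norm argument of
[Schoof2009, Exercise 16.3]) — the Kummer-theoretic inputs of [Schoof2009, Lemma 16.2].

* `Literature.FieldTheory.Kummer.finrank_kummerField_of_prime` — `[L(y) : L] = pᵏ`;
* `Literature.FieldTheory.Kummer.exists_algEquiv_apply_gen_eq` — every exponent vector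
  `a : Fin k → ℤ/p` is realised by some `σ ∈ Gal(L(y)/L)`: `σ(yᵢ) = ζ^{aᵢ} yᵢ`;
* `Literature.FieldTheory.Kummer.IndepModPowers.algebraMap_of_coprime` — independence modulo
  `p`-th powers ascends from `L₀` to a finite extension `L` of degree prime to `p`.

## References

* S. Lang, *Algebra*, 3rd ed., GTM 211, Springer 2002, Ch. VI §8 Thm. 8.1. [Lang2002]
* R. Schoof, *Catalan's Conjecture*, Universitext, Springer 2009, Ch. 16, proof of Lemma 16.2 and
  Exercise 16.3 (PDF pp. 185–188). [Schoof2009]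
-/

noncomputable section

open Polynomial IntermediateField

namespace Literature.FieldTheory.Kummer

variable {L Ω : Type*} [Field L] [Field Ω] [Algebra L Ω]
variable {n : ℕ} [NeZero n] {ζ : L}

/-- **The Kummer field has degree `pᵏ` for a prime exponent `p`** (Lang, *Algebra* VI §8,
Thm. 8.1, with Mathlib's `X_pow_sub_C_irreducible_of_prime` in place of the `√−1`-hypothesis of the
tree's `finrank_kummerField`): if `ζ ∈ L` is a primitive `p`-th root of unity and
`c₁, …, c_k ∈ Lˣ` are independent modulo `p`-th powers, then `[L(c₁^{1/p}, …, c_k^{1/p}) : L] = pᵏ`.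
Induction on `k`: the last step `E' ⊂ E'(y_k)` has degree `p` because `c_k` is not a `p`-th power
in `E' = L(y₁, …, y_{k-1})` — were `c_k = bᵖ` there, the Kummer generators lemma
(`exists_eq_mul_prod_pow`) would give `b = ℓ ∏ yᵢ^{vᵢ}`, whence `c_k = ℓᵖ ∏ cᵢ^{vᵢ}` in `L`,
contradicting independence. [cite: Lang2002, VI §8 Thm 8.1] -/
theorem finrank_kummerField_of_prime (hζ : IsPrimitiveRoot ζ n) (hp : n.Prime) :
    ∀ (k : ℕ) (y : Fin k → Ω) (c : Fin k → L), (∀ i, c i ≠ 0) →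
      (∀ i, y i ^ n = algebraMap L Ω (c i)) → IndepModPowers n c →
      Module.finrank L (kummerField L y) = n ^ k := by
  classical
  have hn : 0 < n := hp.pos
  intro k
  induction k with
  | zero =>
    intro y c _ _ _
    have : kummerField L y = ⊥ := by
      rw [kummerField, Set.range_eq_empty y, IntermediateField.adjoin_empty]
    rw [this, IntermediateField.finrank_bot, pow_zero]
  | succ k ih =>
    intro y c hc hy hH
    -- the initial segment
    set y' : Fin k → Ω := fun i => y (Fin.castSucc i) with hy'def
    set c' : Fin k → L := fun i => c (Fin.castSucc i) with hc'def
    have hc' : ∀ i, c' i ≠ 0 := fun i => hc _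
    have hy' : ∀ i, y' i ^ n = algebraMap L Ω (c' i) := fun i => hy _
    have hH' : IndepModPowers n c' := hH.init
    have hdeg' := ih y' c' hc' hy' hH'
    haveI : IsGalois L (kummerField L y') := isGalois_kummerField hζ y' c' hc' hy'
    set E' : IntermediateField L Ω := kummerField L y' with hE'
    haveI : FiniteDimensional L E' :=
      Module.finite_of_finrank_pos (by rw [hdeg']; exact pow_pos hn k)
    set yk : Ω := y (Fin.last k) with hyk
    set ck : L := c (Fin.last k) with hck
    -- `E = E'(y_k)`
    have hE : (IntermediateField.adjoin E' {yk}).restrictScalars L = kummerField L y := by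
      rw [hE', IntermediateField.adjoin_adjoin_left, kummerField]
      congr 1
      ext r
      simp only [Set.mem_union, Set.mem_range, Set.mem_singleton_iff]
      constructor
      · rintro (⟨i, rfl⟩ | rfl)
        · exact ⟨Fin.castSucc i, rfl⟩
        · exact ⟨Fin.last k, rfl⟩
      · rintro ⟨i, rfl⟩
        refine Fin.lastCases (Or.inr rfl) (fun j => Or.inl ⟨j, rfl⟩) i
    -- `Xᵖ - c_k` is irreducible over `E'`: `c_k` is not a `p`-th power there
    have hirr : Irreducible (X ^ n - Polynomial.C (algebraMap L E' ck)) := by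
      refine X_pow_sub_C_irreducible_of_prime hp fun b hb => ?_
      have hb0 : b ≠ 0 := by
        rintro rfl
        rw [zero_pow hp.ne_zero, eq_comm, map_eq_zero_iff _ (algebraMap L E').injective] at hb
        exact hc _ hb
      have hbΩ : ((b : Ω)) ^ n = algebraMap L Ω ck := by
        have := congrArg (fun x : E' => (x : Ω)) hb
        simpa using this
      obtain ⟨ℓ', v, hbv⟩ := exists_eq_mul_prod_pow hζ y' c' hc' hy' hdeg' (dvd_refl n) hbΩ hb0
      have hℓ'0 : ℓ' ≠ 0 := by
        rintro rfl
        rw [map_zero, zero_mul] at hbv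
        exact hb0 (Subtype.ext hbv)
      -- `c_k = ℓ'ᵖ ∏ c'ᵢ^{vᵢ}` in `L`
      have hstar : ck = ℓ' ^ n * ∏ i, c' i ^ v i := by
        apply (algebraMap L Ω).injective
        rw [← hbΩ, hbv, mul_pow, ← Finset.prod_pow, map_mul, map_pow, map_prod]
        congr 1
        refine Finset.prod_congr rfl fun i _ => ?_
        rw [← pow_mul, mul_comm, pow_mul, hy' i, map_pow]
      -- contradiction with independence: exponent vector `(-v, 1)`
      have key := hH (Fin.snoc (fun i => -(v i : ℤ)) 1) ⟨ℓ', ?_⟩ (Fin.last k)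
      · rw [Fin.snoc_last] at key
        have h1 : (n : ℤ) ≤ 1 := Int.le_of_dvd one_pos key
        have h2 := hp.two_le
        omega
      · rw [Fin.prod_univ_castSucc, Fin.snoc_last, zpow_one]
        simp only [Fin.snoc_castSucc]
        rw [show c (Fin.last k) = ck from rfl, hstar, mul_left_comm, ← zpow_natCast,
          ← Finset.prod_mul_distrib, Finset.prod_eq_one, mul_one]
        intro i _
        rw [← zpow_natCast, ← zpow_add₀ (hc _), neg_add_cancel, zpow_zero]
    -- degree of the last step and the tower law
    have hint : IsIntegral E' yk := by
      refine ⟨X ^ n - Polynomial.C (algebraMap L E' ck), monic_X_pow_sub_C _ hn.ne', ?_⟩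
      rw [eval₂_sub, eval₂_X_pow, eval₂_C]
      change yk ^ n - algebraMap L Ω ck = 0
      rw [hyk, hck, hy, sub_self]
    have hmin : minpoly E' yk = X ^ n - Polynomial.C (algebraMap L E' ck) := by
      refine (minpoly.eq_of_irreducible_of_monic hirr ?_ (monic_X_pow_sub_C _ hn.ne')).symm
      rw [map_sub, map_pow, Polynomial.aeval_X, Polynomial.aeval_C]
      change yk ^ n - algebraMap L Ω ck = 0
      rw [hyk, hck, hy, sub_self]
    have htop : Module.finrank E' (IntermediateField.adjoin E' {yk}) = n := by
      rw [IntermediateField.adjoin.finrank hint, hmin, natDegree_X_pow_sub_C]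
    calc Module.finrank L (kummerField L y)
        = Module.finrank L ((IntermediateField.adjoin E' {yk}).restrictScalars L) := by rw [hE]
      _ = Module.finrank L (IntermediateField.adjoin E' {yk}) := rfl
      _ = Module.finrank L E' * Module.finrank E' (IntermediateField.adjoin E' {yk}) :=
          (Module.finrank_mul_finrank L E' _).symm
      _ = n ^ (k + 1) := by rw [hdeg', htop, pow_succ]

variable {k : ℕ} (y : Fin k → Ω) (c : Fin k → L) (hc : ∀ i, c i ≠ 0)
  (hy : ∀ i, y i ^ n = algebraMap L Ω (c i))

include hc hy in
/-- **Surjectivity of the exponent representation (prime exponent).**  With `ζ ∈ L` a primitive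
`p`-th root of unity, `yᵢᵖ = cᵢ ∈ Lˣ` independent modulo `p`-th powers, every exponent vector
`a ∈ (ℤ/p)ᵏ` is realised by an automorphism of `E = L(y₁, …, y_k)` over `L`:
`σ(yᵢ) = ζ^{aᵢ} yᵢ` for all `i` (`Gal(E/L) ≅ Hom(⟨c⟩ Lˣᵖ/Lˣᵖ, μ_p) ≅ (ℤ/p)ᵏ`; the "Kummer
isomorphism" of [Schoof2009, Ch. 16, proof of Lemma 16.2]). [cite: Lang2002, VI §8 Thm 8.1]
[cite: Schoof2009, Ch. 16 (proof of Lemma 16.2, "Kummer theory implies that the homomorphism … is an isomorphism")] -/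
theorem exists_algEquiv_apply_gen_eq (hζ : IsPrimitiveRoot ζ n) (hp : n.Prime)
    (hind : IndepModPowers n c) (a : Fin k → ZMod n) :
    ∃ σ : kummerField L y ≃ₐ[L] kummerField L y,
      ∀ i, (σ (gen L y i) : Ω) = algebraMap L Ω ζ ^ (a i).val * y i := by
  have hdeg := finrank_kummerField_of_prime hζ hp k y c hc hy hind
  haveI : IsGalois L (kummerField L y) := isGalois_kummerField hζ y c hc hy
  obtain ⟨σ, hσ⟩ := (expntHom_bijective hζ y c hc hy hdeg).2 (Multiplicative.ofAdd a)
  refine ⟨σ, fun i => ?_⟩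
  rw [algEquiv_apply_gen hζ y c hc hy σ i, ← expntHom_apply hζ y c hc hy σ, hσ]
  rfl

omit [NeZero n] in
/-- **Independence modulo `p`-th powers ascends along extensions of degree prime to `p`**
(the norm argument of [Schoof2009, Exercise 16.3]: if `x ^ p = ∏ cᵢ^{vᵢ}` in `L` then, taking
norms to `L₀`, `N(x)ᵖ = ∏ cᵢ^{d vᵢ}` with `d = [L : L₀]`, so `p ∣ d vᵢ` and `p ∣ vᵢ`).
[cite: Schoof2009, Exercise 16.3] -/
theorem IndepModPowers.algebraMap_of_coprime {L₀ : Type*} [Field L₀] [Algebra L₀ L]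
    [FiniteDimensional L₀ L] (hp : n.Prime) (hcop : ¬ n ∣ Module.finrank L₀ L)
    {c : Fin k → L₀} (h : IndepModPowers n c) :
    IndepModPowers n (fun i => algebraMap L₀ L (c i)) := by
  classical
  intro v ⟨x, hx⟩ i
  set d : ℕ := Module.finrank L₀ L with hd
  -- take norms: `N(x)^n = (∏ cᵢ^{vᵢ})^d = ∏ cᵢ^{d vᵢ}`
  have hx' : x ^ n = algebraMap L₀ L (∏ i, c i ^ v i) := by
    rw [hx, map_prod]
    exact Finset.prod_congr rfl fun i _ => (map_zpow₀ (algebraMap L₀ L) (c i) (v i)).symm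
  have hnorm : (Algebra.norm L₀ x) ^ n = ∏ i, c i ^ ((d : ℤ) * v i) := by
    rw [← map_pow, hx', Algebra.norm_algebraMap, ← hd, ← Finset.prod_pow]
    refine Finset.prod_congr rfl fun i _ => ?_
    rw [← zpow_natCast, ← zpow_mul, mul_comm]
  have hdvd := h (fun i => (d : ℤ) * v i) ⟨Algebra.norm L₀ x, hnorm⟩ i
  -- `n ∣ d vᵢ` and `n` prime to `d`
  have hcop' : IsCoprime (n : ℤ) (d : ℤ) := by
    rw [Int.isCoprime_iff_gcd_eq_one, Int.gcd_natCast_natCast]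
    exact (Nat.Prime.coprime_iff_not_dvd hp).mpr hcop
  exact hcop'.dvd_of_dvd_mul_left hdvd

end Literature.FieldTheory.Kummer

end
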